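import Mathlib
import HarnessLib
import Literature.Analysis.FluidPDE.WholeSpaceIBP
import Literature.Analysis.FluidPDE.MildSolutionProofs
import Summits.NavierStokesRegularity.NavierStokesRegularity.Theorems.PoloidalWindowDoorPoloidalWindowRigidityPressureRegime
import Summits.NavierStokesRegularity.NavierStokesRegularity.Theorems.PoloidalWindowDoorPoloidalWindowRigidityPressureOscillation

/-!
# K2 `PoloidalWindowRigidity` (stmt-NavierStokesRegularity-19708) — ON CLOSED-ELLIPTIC SLICES THE HORIZONTAL STRAIN
# IS `L²`-THIN AT LARGE SCALES (superharmonic pressure + the class mean-oscillation bound (F1))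

Cell ns-regularity-ideate, seat nsreg-p7 gen 7 (third worker under the K2 lead ns-poloidal-K2-p1).  An (M)-CONSUMING
consequence of `…PressureRegime` for the boundary of the elliptic stratum that M11 (`…EllipticSlopeUnconditional`,
shear ratio in a compact `[μ₀, μ₁] ⊂ (0,∞)`) does not reach: slices with shear ratio `m(y) ≥ 0` everywhere but
`inf m = 0` or `sup m = ∞` allowed (K2P1-M11-NOTES §2 «the slope enters every neighbourhood of [0,1]»).

* `integral_mul_laplacian_comm` — Green's second identity without boundary on a finite-dimensional inner product
  space: `∫ g Δf = ∫ f Δg` for `f ∈ C²`, `g ∈ C²_c`; `integral_laplacian_eq_zero_of_hasCompactSupport` — `∫ Δg = 0`.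
* `integral_cutoff_horizontalStrain_le` — (`|D_h v_h|²_F + (div_h v_h)²` is written out in coordinates as
  `(∂₀v₀)² + (∂₁v₁)² + 2(∂₁v₀)² + (∂₀v₀ + ∂₁v₁)²`, `∂ⱼvᵢ = Dv(single j 1) i`) for a classical Navier–Stokes solution on a window `(t₀,0)`, a slice `s`
  poloidal along `e₂` with NONNEGATIVE shear ratio everywhere, the tree's cut-off `ζ_R = cutoff R` (`|Δζ_R| ≤ C₂/R²`)
  and ANY constant `c`: `∫ ζ_R (|D_h v_h|²_F + (div_h v_h)²) ≤ (C₂/R²) ∫_{B̄(0,2R)} |p(s) − c|`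
  (pointwise `|D_h v_h|²_F + (div_h v_h)² ≤ −Δp` from `…PressureRegime`, then `∫ ζ(−Δp) = −∫ (p − c) Δζ`).
* `exists_integral_cutoff_horizontalStrain_le_of_class` — for a profile of the route's Type-I class (rate `C`,
  Oseen-mild) with a classical pressure on `(t₀,0)`: ONE constant `K` with
  `∫ ζ_R (|D_h v_h|²_F + (div_h v_h)²)(s) ≤ K · C²/(−s) · |B̄(0,2R)| / R²` for every closed-elliptic poloidal slice
  `s ∈ (t₀,0)` and every `R ≥ 1/2` — i.e. `⟨|D_h²φ|² + (Δ_hφ)²⟩_{B_R} = O(C²/((−s)R²))` against the pointwise rate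
  `C₁²/(−s)²`: on such slices the horizontal potential flow is `L²`-RIGID AT LARGE SCALES (its strain lives on a set of
  parabolic volume `O(R·(−s))` in `B_R`, «tube-like»).  Input (M): the mean-oscillation bound (F1)
  `…PressureOscillation.exists_integral_abs_sub_le_class` (nsreg-p7 g6).

WHAT THIS IS NOT: not a claim about Navier–Stokes regularity and not the crux — a located partial statement on the
boundary of one stratum of the residue S2⁗ (bears_on LADDER-NS N0, route PoloidalWindowDoor, crux K2; `--supports`
the K2 item).
-/

noncomputable section

-- the summit and its single sub-problem share the name (CONVENTIONS §1), as in every Theorems file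
set_option linter.dupNamespace false

namespace Summit.NavierStokesRegularity.NavierStokesRegularity.Theorems.PoloidalWindowDoorPoloidalWindowRigidityEllipticSliceThinStrain

open MeasureTheory Set Function Filter Topology Metric InnerProductSpace
open scoped RealInnerProductSpace Laplacian
open Literature.Analysis Literature.Analysis.FluidPDE Literature.Analysis.UnboundedOperators
open Summit.NavierStokesRegularity.NavierStokesRegularity.Theorems.PoloidalWindowDoorPoloidalWindowRigidityPressureRegime
open Summit.NavierStokesRegularity.NavierStokesRegularity.Theorems.PoloidalWindowDoorPoloidalWindowRigidityPressureOscillation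

/-! ### Green's second identity without boundary -/

section Green

variable {E : Type*} [NormedAddCommGroup E] [InnerProductSpace ℝ E] [FiniteDimensional ℝ E]
  [MeasurableSpace E] [BorelSpace E]

/-- **Green's second identity without boundary**: `∫ g Δf = ∫ f Δg` for `f ∈ C²` and a compactly supported
`g ∈ C²` (Green's first identity twice). -/
theorem integral_mul_laplacian_comm {f g : E → ℝ} (hf : ContDiff ℝ 2 f) (hg : ContDiff ℝ 2 g)
    (hgc : HasCompactSupport g) :
    ∫ x, g x * (Δ f) x = ∫ x, f x * (Δ g) x := by
  set b := stdOrthonormalBasis ℝ E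
  have h1 := integral_inner_laplacian_add_eq_zero b (F' := ℝ) hf (hg.of_le one_le_two) (Or.inr hgc)
  have h2 := integral_inner_laplacian_add_eq_zero b (F' := ℝ) hg (hf.of_le one_le_two) (Or.inl hgc)
  have hsym : ∑ i, ∫ x, ⟪fderiv ℝ f x (b i), fderiv ℝ g x (b i)⟫ =
      ∑ i, ∫ x, ⟪fderiv ℝ g x (b i), fderiv ℝ f x (b i)⟫ := by
    refine Finset.sum_congr rfl fun i _ => integral_congr_ae (Eventually.of_forall fun x => ?_)
    exact real_inner_comm _ _
  have e1 : ∫ x, ⟪(Δ f) x, g x⟫ = ∫ x, g x * (Δ f) x :=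
    integral_congr_ae (Eventually.of_forall fun x =>
      (by rw [RCLike.inner_apply, conj_trivial] : ⟪(Δ f) x, g x⟫ = g x * (Δ f) x))
  have e2 : ∫ x, ⟪(Δ g) x, f x⟫ = ∫ x, f x * (Δ g) x :=
    integral_congr_ae (Eventually.of_forall fun x =>
      (by rw [RCLike.inner_apply, conj_trivial] : ⟪(Δ g) x, f x⟫ = f x * (Δ g) x))
  rw [hsym] at h1
  linarith

/-- `∫ Δg = 0` for a compactly supported `g ∈ C²` (Green against the constant `1`). -/
theorem integral_laplacian_eq_zero_of_hasCompactSupport {g : E → ℝ} (hg : ContDiff ℝ 2 g)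
    (hgc : HasCompactSupport g) : ∫ x, (Δ g) x = 0 := by
  have h := integral_mul_laplacian_comm (f := fun _ : E => (1 : ℝ)) (g := g) contDiff_const hg hgc
  have hΔ1 : (Δ (fun _ : E => (1 : ℝ))) = fun _ => 0 := by
    funext x
    rw [FluidPDE.laplacian_eq_sum_fderiv_fderiv (stdOrthonormalBasis ℝ E) contDiff_const]
    simp
  simp only [hΔ1, mul_zero, integral_zero, one_mul] at h
  exact h.symm

end Green

/-! ### closed-elliptic slices: the horizontal strain against the cut-off -/

variable {v : ℝ → EuclideanSpace ℝ (Fin 3) → EuclideanSpace ℝ (Fin 3)} {p : ℝ → EuclideanSpace ℝ (Fin 3) → ℝ}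

/-- **THE HORIZONTAL STRAIN AGAINST THE CUT-OFF ON A CLOSED-ELLIPTIC SLICE.**  For a classical Navier–Stokes solution
on a window `(t₀, 0)`, a slice `s` poloidal along `e₂` with nonnegative shear ratio `m(y) ≥ 0` everywhere, the cut-off
`ζ_R = cutoff R` with `|Δζ_R| ≤ C₂/R²`, and any constant `c`:
`∫ ζ_R (|D_h v_h|²_F + (div_h v_h)²) ≤ (C₂/R²) ∫_{B̄(0,2R)} |p(s) − c|`. -/
theorem integral_cutoff_horizontalStrain_le {t₀ : ℝ} (hcl : IsClassicalNSSolutionOn (Ioo t₀ 0) 1 0 v p) {s : ℝ}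
    (hs : s ∈ Ioo t₀ 0) (hpol : ∀ y, ⟪curl (v s) y, EuclideanSpace.single 2 1⟫ = 0)
    {m : EuclideanSpace ℝ (Fin 3) → ℝ} (hm0 : ∀ y, 0 ≤ m y)
    (hm : ∀ y, fderiv ℝ (v s) y (EuclideanSpace.single 2 1) 0 = m y * fderiv ℝ (v s) y (EuclideanSpace.single 0 1) 2 ∧
      fderiv ℝ (v s) y (EuclideanSpace.single 2 1) 1 = m y * fderiv ℝ (v s) y (EuclideanSpace.single 1 1) 2)
    {R C₂ : ℝ} (hR : 0 < R) (hC₂ : ∀ x, |(Δ (cutoff (E := EuclideanSpace ℝ (Fin 3)) R)) x| ≤ C₂ / R ^ 2) (c : ℝ) :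
    ∫ y, cutoff (E := EuclideanSpace ℝ (Fin 3)) R y *
        (fderiv ℝ (v s) y (EuclideanSpace.single 0 1) 0 ^ 2 + fderiv ℝ (v s) y (EuclideanSpace.single 1 1) 1 ^ 2 +
            2 * fderiv ℝ (v s) y (EuclideanSpace.single 0 1) 1 ^ 2 +
            (fderiv ℝ (v s) y (EuclideanSpace.single 0 1) 0 + fderiv ℝ (v s) y (EuclideanSpace.single 1 1) 1) ^ 2) ≤
      C₂ / R ^ 2 * ∫ y in closedBall (0 : EuclideanSpace ℝ (Fin 3)) (2 * R), |p s y - c| := by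
  set Sq : EuclideanSpace ℝ (Fin 3) → ℝ := fun y =>
    fderiv ℝ (v s) y (EuclideanSpace.single 0 1) 0 ^ 2 + fderiv ℝ (v s) y (EuclideanSpace.single 1 1) 1 ^ 2 +
      2 * fderiv ℝ (v s) y (EuclideanSpace.single 0 1) 1 ^ 2 +
      (fderiv ℝ (v s) y (EuclideanSpace.single 0 1) 0 + fderiv ℝ (v s) y (EuclideanSpace.single 1 1) 1) ^ 2 with hSq
  show ∫ y, cutoff (E := EuclideanSpace ℝ (Fin 3)) R y * Sq y ≤ _
  set ζ : EuclideanSpace ℝ (Fin 3) → ℝ := cutoff (E := EuclideanSpace ℝ (Fin 3)) R with hζdef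
  set K : Set (EuclideanSpace ℝ (Fin 3)) := closedBall (0 : EuclideanSpace ℝ (Fin 3)) (2 * R) with hKdef
  have hKc : IsCompact K := isCompact_closedBall _ _
  have hζ2 : ContDiff ℝ 2 ζ := (contDiff_cutoff (n := 2) R)
  have hζc : HasCompactSupport ζ := hasCompactSupport_cutoff hR
  have hsupp : tsupport ζ ⊆ K := FluidPDE.tsupport_cutoff_subset hR
  have hζ0 : ∀ x ∉ K, ζ x = 0 := fun x hx => image_eq_zero_of_notMem_tsupport fun h' => hx (hsupp h')
  have hΔζ0 : ∀ x ∉ K, (Δ ζ) x = 0 := fun x hx =>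
    FluidPDE.laplacian_eq_zero_of_notMem_tsupport fun h' => hx (hsupp h')
  -- regularity of the slices
  have hp2 : ContDiff ℝ 2 (p s) := (hcl.contDiff_pressure hs).of_le (by norm_cast)
  have hvs : ContDiff ℝ 1 (v s) := (hcl.contDiff_velocity hs).of_le (by norm_cast)
  have hpc : Continuous (p s) := (hcl.contDiff_pressure hs).continuous
  have hΔpc : Continuous (Δ (p s)) := FluidPDE.continuous_laplacian hp2
  have hΔζc : Continuous (Δ ζ) := FluidPDE.continuous_laplacian hζ2
  have hζcont : Continuous ζ := hζ2.continuous
  have hcoord : ∀ (e : EuclideanSpace ℝ (Fin 3)) (i : Fin 3), Continuous fun y => fderiv ℝ (v s) y e i := by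
    intro e i
    have h1 : Continuous fun y => fderiv ℝ (v s) y e := (hvs.continuous_fderiv one_ne_zero).clm_apply continuous_const
    exact (EuclideanSpace.proj (𝕜 := ℝ) i).continuous.comp h1
  have hSc : Continuous Sq := by
    rw [hSq]
    fun_prop
  have hcs_of : ∀ {g : EuclideanSpace ℝ (Fin 3) → ℝ}, (∀ x ∉ K, g x = 0) → HasCompactSupport g := fun hg =>
    HasCompactSupport.of_support_subset_isCompact hKc fun x hx => by
      by_contra hxK; exact hx (hg x hxK)
  -- step 1: pointwise `ζ S ≤ ζ (−Δp)`
  have hpt : ∀ y, ζ y * Sq y ≤ ζ y * (-(Δ (p s)) y) := fun y =>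
    mul_le_mul_of_nonneg_left
      (horizontalStrain_sq_le_neg_laplacian_pressure hcl (by rwa [isOpen_Ioo.interior_eq])
        (by have h := hpol y; rwa [EuclideanSpace.inner_single_right, one_mul, conj_trivial] at h)
        (hm0 y) (hm y).1 (hm y).2)
      (cutoff_nonneg R y)
  have hi1 : Integrable fun y => ζ y * Sq y :=
    (hζcont.mul hSc).integrable_of_hasCompactSupport
      (hcs_of fun x hx => by simp only [Pi.mul_apply, hζ0 x hx, zero_mul])
  have hi2 : Integrable fun y => ζ y * (-(Δ (p s)) y) :=
    (hζcont.mul hΔpc.neg).integrable_of_hasCompactSupport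
      (hcs_of fun x hx => by simp only [Pi.mul_apply, Pi.neg_apply, hζ0 x hx, zero_mul])
  have hstep1 : ∫ y, ζ y * Sq y ≤ ∫ y, ζ y * (-(Δ (p s)) y) := integral_mono hi1 hi2 hpt
  -- step 2: `∫ ζ(−Δp) = −∫ (p − c) Δζ`
  have hgreen : ∫ y, ζ y * (-(Δ (p s)) y) = -∫ y, (p s y - c) * (Δ ζ) y := by
    have h := integral_mul_laplacian_comm hp2 hζ2 hζc
    have h0 := integral_laplacian_eq_zero_of_hasCompactSupport hζ2 hζc
    have hi3 : Integrable fun y => p s y * (Δ ζ) y :=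
      (hpc.mul hΔζc).integrable_of_hasCompactSupport
        (hcs_of fun x hx => by simp only [Pi.mul_apply, hΔζ0 x hx, mul_zero])
    have hi4 : Integrable fun y => c * (Δ ζ) y :=
      (continuous_const.mul hΔζc).integrable_of_hasCompactSupport
        (hcs_of fun x hx => by simp only [Pi.mul_apply, hΔζ0 x hx, mul_zero])
    have e1 : ∫ y, ζ y * (-(Δ (p s)) y) = -∫ y, ζ y * (Δ (p s)) y := by
      rw [← integral_neg]; refine integral_congr_ae (Eventually.of_forall fun y => ?_); ring
    have e2 : ∫ y, (p s y - c) * (Δ ζ) y = (∫ y, p s y * (Δ ζ) y) - ∫ y, c * (Δ ζ) y := by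
      rw [← integral_sub hi3 hi4]; refine integral_congr_ae (Eventually.of_forall fun y => ?_); ring
    rw [e1, e2, h, integral_const_mul, h0, mul_zero, sub_zero]
  -- step 3: `|∫ (p − c) Δζ| ≤ (C₂/R²) ∫_{B̄(0,2R)} |p − c|`
  have hstep3 : -∫ y, (p s y - c) * (Δ ζ) y ≤ C₂ / R ^ 2 * ∫ y in K, |p s y - c| := by
    have hsupp3 : ∀ x ∉ K, (p s x - c) * (Δ ζ) x = 0 := fun x hx => by rw [hΔζ0 x hx, mul_zero]
    rw [← setIntegral_eq_integral_of_forall_compl_eq_zero hsupp3]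
    have hKm : MeasurableSet K := isClosed_closedBall.measurableSet
    have hKfin : volume K < ⊤ := measure_closedBall_lt_top
    have hi5 : IntegrableOn (fun y => (p s y - c) * (Δ ζ) y) K volume :=
      (((hpc.sub continuous_const).mul hΔζc).continuousOn).integrableOn_compact hKc
    have hi6 : IntegrableOn (fun y => |p s y - c|) K volume :=
      ((hpc.sub continuous_const).abs.continuousOn).integrableOn_compact hKc
    have hC₂0 : 0 ≤ C₂ / R ^ 2 := (abs_nonneg _).trans (hC₂ 0)
    calc -∫ y in K, (p s y - c) * (Δ ζ) y ≤ |∫ y in K, (p s y - c) * (Δ ζ) y| := neg_le_abs _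
      _ ≤ ∫ y in K, |(p s y - c) * (Δ ζ) y| := abs_integral_le_integral_abs
      _ ≤ ∫ y in K, C₂ / R ^ 2 * |p s y - c| := by
          refine setIntegral_mono_on hi5.abs (hi6.const_mul _) hKm fun y _ => ?_
          rw [abs_mul, mul_comm]
          exact mul_le_mul_of_nonneg_right (hC₂ y) (abs_nonneg _)
      _ = C₂ / R ^ 2 * ∫ y in K, |p s y - c| := integral_const_mul _ _
  calc ∫ y, ζ y * Sq y ≤ ∫ y, ζ y * (-(Δ (p s)) y) := hstep1
    _ = -∫ y, (p s y - c) * (Δ ζ) y := hgreen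
    _ ≤ C₂ / R ^ 2 * ∫ y in K, |p s y - c| := hstep3

/-! ### on the route's Type-I class: (F1) makes the bound scale like `R · |B_R| / R² ` -/

variable {C : ℝ}

/-- **ON CLOSED-ELLIPTIC SLICES THE HORIZONTAL STRAIN IS `L²`-THIN AT LARGE SCALES.**  For a profile of the route's
Type-I class (rate `C`, Oseen-mild) and any classical pressure on a window `(t₀,0)` there is ONE constant `K ≥ 0` with:
for every slice `s ∈ (t₀,0)` poloidal along `e₂` whose shear ratio is nonnegative everywhere and every `R ≥ 1/2`,
`∫ cutoff R · (|D_h v_h|²_F + (div_h v_h)²)(s) ≤ K · (C²/(−s)) · |B̄(0,2R)| / R²`.  Since `cutoff R = 1` on `B̄(0,R)`,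
the mean of the horizontal strain over `B(0,R)` is `O(C²/((−s) R²))`, against the pointwise class rate `O(1/(−s)²)`. -/
theorem exists_integral_cutoff_horizontalStrain_le_of_class (hrate : HasTypeITimeDecay C v)
    (hmild : ∀ s t : ℝ, s < t → t < 0 → ∀ y,
      v t y = heatExtension (v s) (t - s) y - oseenDuhamel 1 s v v t y)
    {t₀ : ℝ} (ht₀ : t₀ < 0) (hcl : IsClassicalNSSolutionOn (Ioo t₀ 0) 1 0 v p) :
    ∃ K : ℝ, 0 ≤ K ∧ ∀ s ∈ Ioo t₀ 0, (∀ y, ⟪curl (v s) y, EuclideanSpace.single 2 1⟫ = 0) →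
      ∀ (m : EuclideanSpace ℝ (Fin 3) → ℝ), (∀ y, 0 ≤ m y) →
      (∀ y, fderiv ℝ (v s) y (EuclideanSpace.single 2 1) 0 = m y * fderiv ℝ (v s) y (EuclideanSpace.single 0 1) 2 ∧
        fderiv ℝ (v s) y (EuclideanSpace.single 2 1) 1 = m y * fderiv ℝ (v s) y (EuclideanSpace.single 1 1) 2) →
      ∀ R : ℝ, 1 / 2 ≤ R →
        ∫ y, cutoff (E := EuclideanSpace ℝ (Fin 3)) R y *
        (fderiv ℝ (v s) y (EuclideanSpace.single 0 1) 0 ^ 2 + fderiv ℝ (v s) y (EuclideanSpace.single 1 1) 1 ^ 2 +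
            2 * fderiv ℝ (v s) y (EuclideanSpace.single 0 1) 1 ^ 2 +
            (fderiv ℝ (v s) y (EuclideanSpace.single 0 1) 0 + fderiv ℝ (v s) y (EuclideanSpace.single 1 1) 1) ^ 2) ≤
          K * (C ^ 2 / (-s)) * volume.real (closedBall (0 : EuclideanSpace ℝ (Fin 3)) (2 * R)) / R ^ 2 := by
  obtain ⟨K₁, hK₁0, hF1⟩ := exists_integral_abs_sub_le_class
  obtain ⟨C₂, hC₂0, hC₂⟩ := exists_abs_laplacian_cutoff_le (E := EuclideanSpace ℝ (Fin 3))
  refine ⟨C₂ * K₁, by positivity, fun s hs hpol m hm0 hm R hR => ?_⟩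
  have hR0 : 0 < R := by linarith
  have h2R : (1 : ℝ) ≤ 2 * R := by linarith
  obtain ⟨κ, hκ⟩ := hF1 hrate hmild ht₀ hcl s hs 0 (2 * R) h2R
  have h := integral_cutoff_horizontalStrain_le hcl hs hpol hm0 hm hR0 (hC₂ R hR0) κ
  refine h.trans ?_
  have hC₂R : 0 ≤ C₂ / R ^ 2 := by positivity
  calc C₂ / R ^ 2 * ∫ y in closedBall (0 : EuclideanSpace ℝ (Fin 3)) (2 * R), |p s y - κ|
      ≤ C₂ / R ^ 2 * (K₁ * (C ^ 2 / (-s)) * volume.real (closedBall (0 : EuclideanSpace ℝ (Fin 3)) (2 * R))) :=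
        mul_le_mul_of_nonneg_left hκ hC₂R
    _ = C₂ * K₁ * (C ^ 2 / (-s)) * volume.real (closedBall (0 : EuclideanSpace ℝ (Fin 3)) (2 * R)) / R ^ 2 := by
        ring

end Summit.NavierStokesRegularity.NavierStokesRegularity.Theorems.PoloidalWindowDoorPoloidalWindowRigidityEllipticSliceThinStrain

end
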